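import Literature.NumberTheory.LFunctions.DirichletExplicitRegionComplexAssembly
import Literature.NumberTheory.LFunctions.DirichletExplicitRegionZetaTerm
import HarnessLib

/-!
# McCurley's explicit region: complex zeros of height `|γ| ≤ 1` for characters of order `≥ 5` (§5), PROVED

Topic `Literature/NumberTheory/LFunctions` (namespace `Literature.NumberTheory.LFunctions.McCurleyStechkin`),
continuing `DirichletExplicitRegionComplexPoints.lean`, `…ComplexAssembly.lean` (Lemmas 1–2 analytic
parts), `…ZetaTerm.lean` (Lemma 3) and `…RealZeros.lean` (the endgame). Everything here is PROVED
(standard axioms); no definitions, NO named fact.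

Source: K. S. McCurley, *Explicit zero-free regions for Dirichlet L-functions*, J. Number Theory
**19** (1984) 7–32 [McCurley1984ZFR], **§5 "Proof of Theorem 1, the case |γ| < 1 but |γ| not too
small"**, first case (p. 26): "If `χ` is of order at least 5, then the above difficulty [a principal
power `χ², χ³, χ⁴`] does not arise, and we can proceed as before. Let `1 < σ ≤ 1.15` and let `kₘ` be
the conductor of `χᵐ`. It follows from (27), (28), and Lemmas 5 and 6 that
`a₁/(σ−β) ≤ a₀/(σ−1) + KA log k − 16.746 − a₀s(k) + Σ_{m=2}^{4} aₘ[T(k,kₘ) − K log(k/kₘ)]`, and from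
(37) we obtain `a₁/(σ−β) ≤ a₀/(σ−1) + KA log M`, hence the result" (with `σ = 1 + r/log M`,
`r = 0.33901`, and (30): `a₁r/(a₀ + KAr) − r > 1/R`).

## Main result

* `generic_mid_height`: for `χ` primitive mod `k` with `χ², χ³, χ⁴ ≠ χ₀`, `L ≥ log k`, `L ≥ log 10`,
  and a zero `ρ = β + iγ` of `L(s, χ)` with `|γ| ≤ 1`: `β < 1 − 1/(R L)`, `R = 9.645908801`.
  (With `L = log max(k, k|γ|, 10)` this is the order-`≥ 5`, `|γ| ≤ 1` clause of Theorem 1.)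

Ingredients proved here: the Gamma terms at heights `≤ m` (McCurley's `d(a,m) − K log π`, Lemma 1)
from the monotonicity in `|t|` and the Stirling sandwich of `…ComplexAssembly.lean`
(`gammaDiff_le_box`; `gammaDiff_le_height_one/_two/_three/_four`: `−0.237, −0.038, 0.141, 0.274`
for McCurley's `−0.355, −0.070, 0.129, 0.268`), and the sharper per-prime totals of (36)–(37)
(`tPen_two_le_sharp ≤ 5.85`, `tPen_three_le_sharp ≤ 1.5`, `tPen_five_nonpos`, `sum_tPen_le_sharp ≤ 7.35`
for McCurley's `6.276`), so that the constant of (30) is `≤ −5.6 < 0`.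

## References

* K. S. McCurley, J. Number Theory 19 (1984) 7–32, doi:10.1016/0022-314x(84)90089-1: Lemma 1 and
  table `d(a,m)` (p. 11), §4 (27)–(30), (36)–(37) (pp. 22–25), §5 first case (p. 26). [McCurley1984ZFR]
-/

noncomputable section

open Real Complex

namespace Literature.NumberTheory.LFunctions

namespace McCurleyStechkin

open Literature.Analysis.SpecialFunctions DirichletCharacter

/-! ## Elementary constants -/

/-- `log 3 ≤ 1.0986124`. [folklore] -/
private theorem log_three_le' : Real.log 3 ≤ 1.0986124 := by
  rw [Real.log_le_iff_le_exp (by norm_num)]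
  have h1 : Real.exp 1.0986124 = Real.exp 1 * Real.exp 0.0986124 := by rw [← Real.exp_add]; norm_num
  have h2 : (1.1036384 : ℝ) ≤ Real.exp 0.0986124 := by
    have h := Real.sum_le_exp_of_nonneg (x := (0.0986124 : ℝ)) (by norm_num) 6
    refine le_trans ?_ h
    simp only [Finset.sum_range_succ, Finset.sum_range_zero, Nat.factorial]
    norm_num
  rw [h1]
  have he := Real.exp_one_gt_d9
  nlinarith

/-- `1.098612 ≤ log 3`. [folklore] -/
private theorem log_three_ge' : (1.098612 : ℝ) ≤ Real.log 3 := by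
  rw [Real.le_log_iff_exp_le (by norm_num)]
  have h1 : Real.exp 1.098612 = Real.exp 1 * Real.exp 0.098612 := by rw [← Real.exp_add]; norm_num
  have h2 : Real.exp 0.098612 ≤ 1.1036381 := by
    have h := Real.exp_bound' (x := (0.098612 : ℝ)) (by norm_num) (by norm_num) (n := 5) (by norm_num)
    refine h.trans ?_
    simp only [Finset.sum_range_succ, Finset.sum_range_zero, Nat.factorial]
    norm_num
  rw [h1]
  have := Real.exp_one_lt_d9
  nlinarith [Real.exp_pos 0.098612]

/-- `1.609437 ≤ log 5`. [folklore] -/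
private theorem log_five_ge' : (1.609437 : ℝ) ≤ Real.log 5 := by
  rw [Real.le_log_iff_exp_le (by norm_num)]
  have h1 : Real.exp 1.609437 = Real.exp 1 * Real.exp 0.609437 := by rw [← Real.exp_add]; norm_num
  have h2 : Real.exp 0.609437 ≤ 1.839396 := by
    have h := Real.exp_bound' (x := (0.609437 : ℝ)) (by norm_num) (by norm_num) (n := 7) (by norm_num)
    refine h.trans ?_
    simp only [Finset.sum_range_succ, Finset.sum_range_zero, Nat.factorial]
    norm_num
  rw [h1]
  have := Real.exp_one_lt_d9
  nlinarith [Real.exp_pos 0.609437]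

/-- `1.1447 ≤ log π`. [folklore] -/
private theorem log_pi_ge'' : (1.1447 : ℝ) ≤ Real.log π := by
  rw [Real.le_log_iff_exp_le Real.pi_pos]
  have h1 : Real.exp 1.1447 = Real.exp 1 * Real.exp 0.1447 := by rw [← Real.exp_add]; norm_num
  have h2 : Real.exp 0.1447 ≤ 1.1556934 := by
    have h := Real.exp_bound' (x := (0.1447 : ℝ)) (by norm_num) (by norm_num) (n := 5) (by norm_num)
    refine h.trans ?_
    simp only [Finset.sum_range_succ, Finset.sum_range_zero, Nat.factorial]
    norm_num
  rw [h1]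
  have := Real.exp_one_lt_d9
  have := Real.pi_gt_d6
  nlinarith [Real.exp_pos 0.1447]

/-- `2/π² ≤ 0.20265`. [folklore] -/
private theorem two_div_pi_sq_le : 2 / π ^ 2 ≤ 0.20265 := by
  have hπ := Real.pi_gt_d6
  have h : (3.141592 : ℝ) ^ 2 ≤ π ^ 2 := pow_le_pow_left₀ (by norm_num) hπ.le 2
  rw [div_le_iff₀ (by positivity)]
  nlinarith

/-- `log 10 ≥ 2.30258`. [folklore] -/
private theorem log_ten_ge'' : (2.30258 : ℝ) ≤ Real.log 10 := by
  have h : Real.log 10 = Real.log 2 + Real.log 5 := by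
    rw [show (10 : ℝ) = 2 * 5 by norm_num, Real.log_mul (by norm_num) (by norm_num)]
  rw [h]
  have h2 := Real.log_two_gt_d9
  have h5 := log_five_ge'
  linarith

/-! ## The Gamma terms at heights `|t| ≤ m` (Lemma 1 with the Stirling sandwich) -/

/-- `Re Γℝ'/Γℝ(u + it + a) = −½ log π + ½ Re ψ((u+a)/2 + it/2)` (`u > 0`). [cite: McCurley1984ZFR, (13)] -/
private theorem re_logDeriv_Gammaℝ_eq {u : ℝ} (hu : 0 < u) (a : ℕ) (t : ℝ) :
    (logDeriv Gammaℝ ((u : ℂ) + t * I + a)).re =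
      -(Real.log π) / 2 + (Complex.digamma ((((u + a) / 2 : ℝ)) + (t / 2 : ℝ) * I)).re / 2 := by
  have hre : 0 < ((u : ℂ) + t * I + a).re := by simp; positivity
  rw [Literature.NumberTheory.LFunctions.logDeriv_Gammaℝ (half_ne_neg_nat_of_re_pos' hre),
    add_re, neg_div, neg_re, div_ofNat_re, div_ofNat_re, ← Complex.ofReal_log Real.pi_pos.le,
    ofReal_re, show ((u : ℂ) + t * I + a) / 2 = (((u + a) / 2 : ℝ) : ℂ) + ((t / 2 : ℝ) : ℂ) * I by
      push_cast; ring]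
  ring

/-- **The Gamma difference in a box (Lemma 1 with Stirling).** For `σ > 0`, parity `a`, `|t| ≤ T`,
and any lower bound `ℓ ≤ ψ((σ₁+a)/2)`, with `x = (σ+a)/2`, `y = T/2`:
`gammaDiff a σ t ≤ −K log π + ½[½ log(x²+y²) − x/(2(x²+y²)) + (2/π²)/(x²+y²) − κℓ]`
(monotonicity in `|t|`, `gammaDiff_le_of_abs_le`; Lehman's Stirling sandwich,
`abs_re_digamma_vertical_sub_le`). [cite: McCurley1984ZFR, Lemma 1 ((7)–(8))] -/
theorem gammaDiff_le_box (a : ℕ) {σ : ℝ} (hσ : 0 < σ) {t T : ℝ} (hT : |t| ≤ T) {ℓ : ℝ}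
    (hℓ : ℓ ≤ (Complex.digamma (((sigmaOne σ + a) / 2 : ℝ) : ℂ)).re) :
    gammaDiff a σ t ≤ -bigK * Real.log π
      + ((Real.log (((σ + a) / 2) ^ 2 + (T / 2) ^ 2) / 2
          - ((σ + a) / 2) / (2 * (((σ + a) / 2) ^ 2 + (T / 2) ^ 2))
          + 2 / π ^ 2 / (((σ + a) / 2) ^ 2 + (T / 2) ^ 2)) - kappa * ℓ) / 2 := by
  have hσ₁ : 0 < sigmaOne σ := hσ.trans (lt_sigmaOne hσ)
  have h := gammaDiff_le_of_abs_le a hσ hT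
  rw [re_logDeriv_Gammaℝ_eq hσ a T, show ((sigmaOne σ : ℂ) + a) = (sigmaOne σ : ℂ) + (0 : ℝ) * I + a by
    push_cast; ring, re_logDeriv_Gammaℝ_eq hσ₁ a 0] at h
  have e0 : (((sigmaOne σ + a) / 2 : ℝ) : ℂ) + (((0 : ℝ) / 2 : ℝ) : ℂ) * I =
      (((sigmaOne σ + a) / 2 : ℝ) : ℂ) := by push_cast; ring
  rw [e0] at h
  have hx : 0 < (σ + a) / 2 := by positivity
  have hS := (abs_le.1 (abs_re_digamma_vertical_sub_le hx (T / 2))).2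
  have hk := kappa_pos
  have hkl : kappa * ℓ ≤ kappa * (Complex.digamma (((sigmaOne σ + a) / 2 : ℝ) : ℂ)).re :=
    mul_le_mul_of_nonneg_left hℓ hk.le
  unfold bigK
  linarith

/-- The bracket of `gammaDiff_le_box` on a box `x ∈ [x₋, x₊]`: monotone pieces.
[cite: McCurley1984ZFR, Lemma 1 ((8): termwise in σ)] -/
private theorem bracket_le {x y xlo xhi LU : ℝ} (hxlo0 : 0 < xlo) (hxlo : xlo ≤ x) (hxhi : x ≤ xhi)
    (hLU : Real.log (xhi ^ 2 + y ^ 2) ≤ LU) :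
    Real.log (x ^ 2 + y ^ 2) / 2 - x / (2 * (x ^ 2 + y ^ 2)) + 2 / π ^ 2 / (x ^ 2 + y ^ 2) ≤
      LU / 2 - xlo / (2 * (xhi ^ 2 + y ^ 2)) + 0.20265 / (xlo ^ 2 + y ^ 2) := by
  have hx0 : 0 < x := by linarith
  have hUlo : xlo ^ 2 + y ^ 2 ≤ x ^ 2 + y ^ 2 := by nlinarith
  have hUhi : x ^ 2 + y ^ 2 ≤ xhi ^ 2 + y ^ 2 := by nlinarith
  have hU0 : 0 < xlo ^ 2 + y ^ 2 := by positivity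
  have h1 : Real.log (x ^ 2 + y ^ 2) ≤ LU :=
    (Real.log_le_log (by positivity) hUhi).trans hLU
  have h2 : xlo / (2 * (xhi ^ 2 + y ^ 2)) ≤ x / (2 * (x ^ 2 + y ^ 2)) :=
    div_le_div₀ hx0.le hxlo (by positivity) (by linarith)
  have h3 : 2 / π ^ 2 / (x ^ 2 + y ^ 2) ≤ 0.20265 / (xlo ^ 2 + y ^ 2) :=
    div_le_div₀ (by norm_num) two_div_pi_sq_le hU0 hUlo
  linarith

/-- The real lower bounds for `ψ((σ₁+a)/2)`: `ψ ≥ −0.9788` (`a = 0`, `(σ₁)/2 ≥ 0.809`),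
`ψ ≥ −0.1718` (`a = 1`, `(σ₁+1)/2 ≥ 1.309`). [cite: McCurley1984ZFR, Lemma 1 (proof: "ψ(0.805 + a/2)")] -/
private theorem ell_le (a : ℕ) (ha : a ≤ 1) {σ : ℝ} (hσ : 1 ≤ σ) :
    (if a = 0 then (-0.9788 : ℝ) else -0.1718) ≤ (Complex.digamma (((sigmaOne σ + a) / 2 : ℝ) : ℂ)).re := by
  have hσ₁ := sigmaOne_gt_1618 hσ
  interval_cases a
  · simp only [if_true, Nat.cast_zero, add_zero]
    exact re_digamma_ge_at_08 (by linarith)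
  · simp only [one_ne_zero, if_false, Nat.cast_one]
    exact re_digamma_ge_at_13 (by linarith)

/-- **Height `≤ 1`:** `gammaDiff a σ t ≤ −0.237` for `a ≤ 1`, `1 < σ ≤ 1.15`, `|t| ≤ 1`
(McCurley: `d(a,1) − K log π = −0.355`). [cite: McCurley1984ZFR, Lemma 1 (table, m = 1)] -/
theorem gammaDiff_le_height_one {a : ℕ} (ha : a ≤ 1) {σ : ℝ} (hσ : 1 < σ) (hσ' : σ ≤ 1.15) {t : ℝ}
    (ht : |t| ≤ 1) : gammaDiff a σ t ≤ -0.237 := by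
  have h := gammaDiff_le_box a (by linarith) ht (ell_le a ha hσ.le)
  have hlp := log_pi_ge''
  have hK := bigK_gt
  have hk := kappa_lt
  have hk0 := kappa_pos
  have l2 := Real.log_two_lt_d9
  have l2' := Real.log_two_gt_d9
  have l3 := log_three_le'
  have l3' := log_three_ge'
  have l5 := log_five_ge'
  interval_cases a
  · simp only [Nat.cast_zero, add_zero, if_true] at h
    have hLU : Real.log ((1.15 / 2) ^ 2 + (1 / 2) ^ 2) ≤ -0.5108 := by
      have : Real.log ((1.15 / 2 : ℝ) ^ 2 + (1 / 2) ^ 2) ≤ Real.log (3 / 5) :=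
        Real.log_le_log (by norm_num) (by norm_num)
      rw [Real.log_div (by norm_num) (by norm_num)] at this
      linarith
    have hb := bracket_le (x := σ / 2) (y := 1 / 2) (xlo := 1 / 2) (xhi := 1.15 / 2) (by norm_num)
      (by linarith) (by linarith) hLU
    norm_num at h hb ⊢
    nlinarith
  · simp only [Nat.cast_one, one_ne_zero, if_false] at h
    have hLU : Real.log (((1.15 + 1) / 2) ^ 2 + (1 / 2) ^ 2) ≤ 0.34658 := by
      have h1 : Real.log ((((1.15 : ℝ) + 1) / 2) ^ 2 + (1 / 2) ^ 2) ≤ Real.log (Real.sqrt 2) := by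
        refine Real.log_le_log (by norm_num) ?_
        rw [show ((((1.15 : ℝ) + 1) / 2) ^ 2 + (1 / 2) ^ 2) = Real.sqrt (((((1.15 : ℝ) + 1) / 2) ^ 2 + (1 / 2) ^ 2) ^ 2) by
          rw [Real.sqrt_sq (by norm_num)]]
        exact Real.sqrt_le_sqrt (by norm_num)
      rw [Real.log_sqrt (by norm_num)] at h1
      linarith
    have hb := bracket_le (x := (σ + 1) / 2) (y := 1 / 2) (xlo := 1) (xhi := (1.15 + 1) / 2) (by norm_num)
      (by linarith) (by linarith) hLU
    norm_num at h hb ⊢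
    nlinarith

/-- **Height `≤ 2`:** `gammaDiff a σ t ≤ −0.038` for `a ≤ 1`, `1 < σ ≤ 1.15`, `|t| ≤ 2`
(McCurley: `d(a,2) − K log π = −0.070`). [cite: McCurley1984ZFR, Lemma 1 (table, m = 2)] -/
theorem gammaDiff_le_height_two {a : ℕ} (ha : a ≤ 1) {σ : ℝ} (hσ : 1 < σ) (hσ' : σ ≤ 1.15) {t : ℝ}
    (ht : |t| ≤ 2) : gammaDiff a σ t ≤ -0.038 := by
  have h := gammaDiff_le_box a (by linarith) ht (ell_le a ha hσ.le)
  have hlp := log_pi_ge''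
  have hK := bigK_gt
  have hk := kappa_lt
  have hk0 := kappa_pos
  have l2 := Real.log_two_lt_d9
  have l2' := Real.log_two_gt_d9
  have l3 := log_three_le'
  have l3' := log_three_ge'
  have l5 := log_five_ge'
  interval_cases a
  · simp only [Nat.cast_zero, add_zero, if_true] at h
    have hLU : Real.log ((1.15 / 2) ^ 2 + (2 / 2) ^ 2) ≤ 0.28769 := by
      have : Real.log ((1.15 / 2 : ℝ) ^ 2 + (2 / 2) ^ 2) ≤ Real.log (4 / 3) :=
        Real.log_le_log (by norm_num) (by norm_num)
      rw [Real.log_div (by norm_num) (by norm_num), show (4 : ℝ) = 2 ^ 2 by norm_num, Real.log_pow] at this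
      push_cast at this
      linarith
    have hb := bracket_le (x := σ / 2) (y := 2 / 2) (xlo := 1 / 2) (xhi := 1.15 / 2) (by norm_num)
      (by linarith) (by linarith) hLU
    norm_num at h hb ⊢
    nlinarith
  · simp only [Nat.cast_one, one_ne_zero, if_false] at h
    have hLU : Real.log (((1.15 + 1) / 2) ^ 2 + (2 / 2) ^ 2) ≤ 0.81094 := by
      have : Real.log ((((1.15 : ℝ) + 1) / 2) ^ 2 + (2 / 2) ^ 2) ≤ Real.log (9 / 4) :=
        Real.log_le_log (by norm_num) (by norm_num)
      rw [Real.log_div (by norm_num) (by norm_num), show (9 : ℝ) = 3 ^ 2 by norm_num,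
        show (4 : ℝ) = 2 ^ 2 by norm_num, Real.log_pow, Real.log_pow] at this
      push_cast at this
      linarith
    have hb := bracket_le (x := (σ + 1) / 2) (y := 2 / 2) (xlo := 1) (xhi := (1.15 + 1) / 2) (by norm_num)
      (by linarith) (by linarith) hLU
    norm_num at h hb ⊢
    nlinarith

/-- **Height `≤ 3`:** `gammaDiff a σ t ≤ 0.141` for `a ≤ 1`, `1 < σ ≤ 1.15`, `|t| ≤ 3`
(McCurley: `d(a,3) − K log π = 0.129`). [cite: McCurley1984ZFR, Lemma 1 (table, m = 3)] -/
theorem gammaDiff_le_height_three {a : ℕ} (ha : a ≤ 1) {σ : ℝ} (hσ : 1 < σ) (hσ' : σ ≤ 1.15)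
    {t : ℝ} (ht : |t| ≤ 3) : gammaDiff a σ t ≤ 0.141 := by
  have h := gammaDiff_le_box a (by linarith) ht (ell_le a ha hσ.le)
  have hlp := log_pi_ge''
  have hK := bigK_gt
  have hk := kappa_lt
  have hk0 := kappa_pos
  have l2 := Real.log_two_lt_d9
  have l2' := Real.log_two_gt_d9
  have l3 := log_three_le'
  have l3' := log_three_ge'
  have l5 := log_five_ge'
  interval_cases a
  · simp only [Nat.cast_zero, add_zero, if_true] at h
    have hLU : Real.log ((1.15 / 2) ^ 2 + (3 / 2) ^ 2) ≤ 0.98083 := by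
      have : Real.log ((1.15 / 2 : ℝ) ^ 2 + (3 / 2) ^ 2) ≤ Real.log (8 / 3) :=
        Real.log_le_log (by norm_num) (by norm_num)
      rw [Real.log_div (by norm_num) (by norm_num), show (8 : ℝ) = 2 ^ 3 by norm_num, Real.log_pow] at this
      push_cast at this
      linarith
    have hb := bracket_le (x := σ / 2) (y := 3 / 2) (xlo := 1 / 2) (xhi := 1.15 / 2) (by norm_num)
      (by linarith) (by linarith) hLU
    norm_num at h hb ⊢
    nlinarith
  · simp only [Nat.cast_one, one_ne_zero, if_false] at h
    have hLU : Real.log (((1.15 + 1) / 2) ^ 2 + (3 / 2) ^ 2) ≤ 1.28094 := by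
      have : Real.log ((((1.15 : ℝ) + 1) / 2) ^ 2 + (3 / 2) ^ 2) ≤ Real.log (18 / 5) :=
        Real.log_le_log (by norm_num) (by norm_num)
      rw [Real.log_div (by norm_num) (by norm_num), show (18 : ℝ) = 3 ^ 2 * 2 by norm_num,
        Real.log_mul (by norm_num) (by norm_num), Real.log_pow] at this
      push_cast at this
      linarith
    have hb := bracket_le (x := (σ + 1) / 2) (y := 3 / 2) (xlo := 1) (xhi := (1.15 + 1) / 2) (by norm_num)
      (by linarith) (by linarith) hLU
    norm_num at h hb ⊢
    nlinarith

/-- **Height `≤ 4`:** `gammaDiff a σ t ≤ 0.274` for `a ≤ 1`, `1 < σ ≤ 1.15`, `|t| ≤ 4`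
(McCurley: `d(a,4) − K log π = 0.268`). [cite: McCurley1984ZFR, Lemma 1 (table, m = 4)] -/
theorem gammaDiff_le_height_four {a : ℕ} (ha : a ≤ 1) {σ : ℝ} (hσ : 1 < σ) (hσ' : σ ≤ 1.15) {t : ℝ}
    (ht : |t| ≤ 4) : gammaDiff a σ t ≤ 0.274 := by
  have h := gammaDiff_le_box a (by linarith) ht (ell_le a ha hσ.le)
  have hlp := log_pi_ge''
  have hK := bigK_gt
  have hk := kappa_lt
  have hk0 := kappa_pos
  have l2 := Real.log_two_lt_d9
  have l2' := Real.log_two_gt_d9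
  have l3 := log_three_le'
  have l3' := log_three_ge'
  have l5 := log_five_ge'
  interval_cases a
  · simp only [Nat.cast_zero, add_zero, if_true] at h
    have hLU : Real.log ((1.15 / 2) ^ 2 + (4 / 2) ^ 2) ≤ 1.50408 := by
      have : Real.log ((1.15 / 2 : ℝ) ^ 2 + (4 / 2) ^ 2) ≤ Real.log (9 / 2) :=
        Real.log_le_log (by norm_num) (by norm_num)
      rw [Real.log_div (by norm_num) (by norm_num), show (9 : ℝ) = 3 ^ 2 by norm_num, Real.log_pow] at this
      push_cast at this
      linarith
    have hb := bracket_le (x := σ / 2) (y := 4 / 2) (xlo := 1 / 2) (xhi := 1.15 / 2) (by norm_num)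
      (by linarith) (by linarith) hLU
    norm_num at h hb ⊢
    nlinarith
  · simp only [Nat.cast_one, one_ne_zero, if_false] at h
    have hLU : Real.log (((1.15 + 1) / 2) ^ 2 + (4 / 2) ^ 2) ≤ 1.67398 := by
      have : Real.log ((((1.15 : ℝ) + 1) / 2) ^ 2 + (4 / 2) ^ 2) ≤ Real.log (16 / 3) :=
        Real.log_le_log (by norm_num) (by norm_num)
      rw [Real.log_div (by norm_num) (by norm_num), show (16 : ℝ) = 2 ^ 4 by norm_num, Real.log_pow] at this
      push_cast at this
      linarith
    have hb := bracket_le (x := (σ + 1) / 2) (y := 4 / 2) (xlo := 1) (xhi := (1.15 + 1) / 2) (by norm_num)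
      (by linarith) (by linarith) hLU
    norm_num at h hb ⊢
    nlinarith

/-! ## The per-prime totals (36)–(37), sharpened by evaluating at `σ → 1⁺` -/

/-- `1.41421 < √2`, `1.73205 < √3`, `2.236 < √5`. [folklore] -/
private theorem sqrt_lower_bounds' :
    (1.41421 : ℝ) < Real.sqrt 2 ∧ (1.73205 : ℝ) < Real.sqrt 3 ∧ (2.236 : ℝ) < Real.sqrt 5 := by
  refine ⟨?_, ?_, ?_⟩
  · rw [show (1.41421 : ℝ) = Real.sqrt (1.41421 ^ 2) by rw [Real.sqrt_sq (by norm_num)]]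
    exact Real.sqrt_lt_sqrt (by norm_num) (by norm_num)
  · rw [show (1.73205 : ℝ) = Real.sqrt (1.73205 ^ 2) by rw [Real.sqrt_sq (by norm_num)]]
    exact Real.sqrt_lt_sqrt (by norm_num) (by norm_num)
  · rw [show (2.236 : ℝ) = Real.sqrt (2.236 ^ 2) by rw [Real.sqrt_sq (by norm_num)]]
    exact Real.sqrt_lt_sqrt (by norm_num) (by norm_num)

/-- **The total `T(p,σ)` through its sign-split.** For `p` prime and `σ > 1`: if `G(p,σ) ≤ 0` then
`T(p,σ) ≤ 0`; otherwise `T(p,σ) = (A'−a₀)U(p,σ) + (A'+a₀)κU(p,σ₁) − A'K log p` with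
`U(p,σ) ≤ log p/(p−1)`, `U(p,σ₁) ≤ log p/(p√p − 1)` (`A' = a₂+a₃+a₄ > a₀`).
[cite: McCurley1984ZFR, §4 (36)] -/
private theorem tPen_le_of {p : ℕ} (hp : 2 ≤ p) {σ : ℝ} (hσ : 1 < σ) {A B s : ℝ}
    (hA : Real.log p ≤ A) (hB : B ≤ Real.log p) (hB0 : 0 ≤ B) (hs : s ≤ Real.sqrt p)
    (hs1 : 1 < (p : ℝ) * s) :
    tPen p σ ≤ max ((rsA234 - rsA0) * (A / ((p : ℝ) - 1))
      + (rsA234 + rsA0) * (0.44723 * (A / ((p : ℝ) * s - 1))) - rsA234 * (0.276385 * B)) 0 := by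
  have hp1 : (1 : ℝ) < p := by exact_mod_cast hp
  have hlog0 : 0 ≤ Real.log p := Real.log_nonneg hp1.le
  have hU := uCorr_le_of_one_le hp hσ.le
  have hU1 := uCorr_sigmaOne_le hp hσ.le
  have hU0 : 0 ≤ uCorr p σ := uCorr_nonneg hp (by linarith)
  have hU10 : 0 ≤ uCorr p (sigmaOne σ) := uCorr_nonneg hp (by linarith [one_lt_sigmaOne hσ.le])
  have hden : (p : ℝ) * s - 1 ≤ (p : ℝ) * Real.sqrt p - 1 := by nlinarith
  have h1 : uCorr p σ ≤ A / ((p : ℝ) - 1) := hU.trans (div_le_div_of_nonneg_right hA (by linarith))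
  have h2 : uCorr p (sigmaOne σ) ≤ A / ((p : ℝ) * s - 1) := by
    refine hU1.trans ?_
    calc Real.log p / ((p : ℝ) * Real.sqrt p - 1) ≤ Real.log p / ((p : ℝ) * s - 1) :=
          div_le_div_of_nonneg_left hlog0 (by linarith) hden
      _ ≤ A / ((p : ℝ) * s - 1) := div_le_div_of_nonneg_right hA (by linarith)
  have hk := kappa_lt
  have hk0 := kappa_pos
  have hK := bigK_gt
  have hA' : rsA234 = 17.43298784 := rsA234_eq
  have ha0 : rsA0 = 11.1859355312082048 := rfl
  by_cases hG : gPen p σ ≤ 0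
  · refine le_trans ?_ (le_max_right _ _)
    unfold tPen
    rw [max_eq_right hG, hA', ha0]
    nlinarith [help_nonneg hp hσ]
  · push Not at hG
    refine le_trans ?_ (le_max_left _ _)
    unfold tPen
    rw [max_eq_left hG.le]
    unfold gPen
    have h3 : kappa * uCorr p (sigmaOne σ) ≤ 0.44723 * (A / ((p : ℝ) * s - 1)) := by
      calc kappa * uCorr p (sigmaOne σ) ≤ kappa * (A / ((p : ℝ) * s - 1)) :=
            mul_le_mul_of_nonneg_left h2 hk0.le
        _ ≤ 0.44723 * (A / ((p : ℝ) * s - 1)) := mul_le_mul_of_nonneg_right hk.le (hU10.trans h2)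
    have h4 : 0.276385 * B ≤ bigK * Real.log p := by
      calc 0.276385 * B ≤ bigK * B := mul_le_mul_of_nonneg_right hK.le hB0
        _ ≤ bigK * Real.log p := mul_le_mul_of_nonneg_left hB bigK_pos.le
    rw [hA', ha0] at *
    nlinarith [h1, h3, h4, hU0, hU10, hk0]

/-- **`p = 2`**: `T(2,σ) ≤ 5.85` for `σ > 1` (McCurley's term "less than 2.179" is for the quadratic
case; the generic (36) at `p = 2` is `≈ 5.28`). [cite: McCurley1984ZFR, §4 (36)–(37)] -/
theorem tPen_two_le_sharp {σ : ℝ} (hσ : 1 < σ) : tPen 2 σ ≤ 5.85 := by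
  obtain ⟨hs2, -, -⟩ := sqrt_lower_bounds'
  have h := tPen_le_of (p := 2) le_rfl hσ (A := 0.6931471808) (B := 0.6931471803) (s := 1.41421)
    (by exact_mod_cast Real.log_two_lt_d9.le) (by exact_mod_cast Real.log_two_gt_d9.le) (by norm_num)
    (by exact_mod_cast hs2.le) (by norm_num)
  refine h.trans (max_le ?_ (by norm_num))
  rw [rsA234_eq]; simp only [rsA0]; norm_num

/-- **`p = 3`**: `T(3,σ) ≤ 1.5` for `σ > 1`. [cite: McCurley1984ZFR, §4 (36)–(37)] -/
theorem tPen_three_le_sharp {σ : ℝ} (hσ : 1 < σ) : tPen 3 σ ≤ 1.5 := by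
  obtain ⟨-, hs3, -⟩ := sqrt_lower_bounds'
  have h := tPen_le_of (p := 3) (by norm_num) hσ (A := 1.0986124) (B := 1.098612) (s := 1.73205)
    (by exact_mod_cast log_three_le') (by exact_mod_cast log_three_ge') (by norm_num)
    (by exact_mod_cast hs3.le) (by norm_num)
  refine h.trans (max_le ?_ (by norm_num))
  rw [rsA234_eq]; simp only [rsA0]; norm_num

/-- **`p = 5`**: `T(5,σ) ≤ 0` for `σ > 1` ("the terms … are negative for `p ≥ p₁`, `p₁` is 5 or 7").
[cite: McCurley1984ZFR, §4 (36)–(37)] -/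
theorem tPen_five_nonpos {σ : ℝ} (hσ : 1 < σ) : tPen 5 σ ≤ 0 := by
  obtain ⟨-, -, hs5⟩ := sqrt_lower_bounds'
  have h := tPen_le_of (p := 5) (by norm_num) hσ (A := 1.6094380) (B := 1.609437) (s := 2.236)
    ?_ (by exact_mod_cast log_five_ge') (by norm_num) (by exact_mod_cast hs5.le) (by norm_num)
  · refine h.trans (max_le ?_ le_rfl)
    rw [rsA234_eq]; simp only [rsA0]; norm_num
  · -- `log 5 ≤ 1.609438`
    rw [Real.log_le_iff_le_exp (by norm_num)]
    have h1 : Real.exp (1.6094380 : ℝ) = Real.exp 1 * Real.exp 0.609438 := by rw [← Real.exp_add]; norm_num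
    have h2 : (1.8393973 : ℝ) ≤ Real.exp 0.609438 := by
      have h := Real.sum_le_exp_of_nonneg (x := (0.609438 : ℝ)) (by norm_num) 9
      refine le_trans ?_ h
      simp only [Finset.sum_range_succ, Finset.sum_range_zero, Nat.factorial]
      norm_num
    push_cast
    rw [h1]
    have he := Real.exp_one_gt_d9
    nlinarith

/-- **(37), sharpened**: for every modulus `k` and `σ > 1`, `Σ_{p∣k} T(p,σ) ≤ 7.35`
(McCurley: `6.276`; the tree's `sum_tPen_le` gives `16.19` on `σ ≤ 1.3`). [cite: McCurley1984ZFR, §4 (37)] -/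
theorem sum_tPen_le_sharp (k : ℕ) {σ : ℝ} (hσ : 1 < σ) :
    ∑ p ∈ k.primeFactors, tPen p σ ≤ 7.35 := by
  classical
  set b : ℕ → ℝ := fun p ↦ if p = 2 then 5.85 else if p = 3 then 1.5 else 0 with hbdef
  have hb0 : ∀ p, 0 ≤ b p := by
    intro p; simp only [hbdef]; split_ifs <;> norm_num
  have hle : ∀ p ∈ k.primeFactors, tPen p σ ≤ b p := by
    intro p hp
    have hpP := Nat.prime_of_mem_primeFactors hp
    simp only [hbdef]
    by_cases h2 : p = 2
    · subst h2; rw [if_pos rfl]; exact tPen_two_le_sharp hσ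
    by_cases h3 : p = 3
    · subst h3; rw [if_neg (by norm_num), if_pos rfl]; exact tPen_three_le_sharp hσ
    by_cases h5 : p = 5
    · subst h5; rw [if_neg (by norm_num), if_neg (by norm_num)]; exact tPen_five_nonpos hσ
    have h7 : 7 ≤ p := by
      have h2' := hpP.two_le
      by_contra hlt
      have hlt' : p < 7 := not_le.1 hlt
      interval_cases p
      all_goals first | omega | exact absurd hpP (by decide)
    rw [if_neg h2, if_neg h3]
    exact tPen_nonpos_of_seven_le h7 hσ
  have hsub : ∑ p ∈ k.primeFactors, b p ≤ ∑ p ∈ ({2, 3} : Finset ℕ), b p := by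
    have hsplit : ∑ p ∈ k.primeFactors, b p =
        ∑ p ∈ k.primeFactors.filter (fun p ↦ p ∈ ({2, 3} : Finset ℕ)), b p := by
      rw [Finset.sum_filter]
      refine Finset.sum_congr rfl fun p _ ↦ ?_
      by_cases h : p ∈ ({2, 3} : Finset ℕ)
      · rw [if_pos h]
      · rw [if_neg h]
        simp only [Finset.mem_insert, Finset.mem_singleton, not_or] at h
        simp [hbdef, h.1, h.2]
    rw [hsplit]
    exact Finset.sum_le_sum_of_subset_of_nonneg (fun p hp ↦ (Finset.mem_filter.1 hp).2)
      fun p _ _ ↦ hb0 p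
  have hval : ∑ p ∈ ({2, 3} : Finset ℕ), b p = 7.35 := by
    simp [hbdef]; norm_num
  calc ∑ p ∈ k.primeFactors, tPen p σ ≤ ∑ p ∈ k.primeFactors, b p := Finset.sum_le_sum hle
    _ ≤ 7.35 := by rw [← hval]; exact hsub

/-! ## §5, characters of order `≥ 5`, `|γ| ≤ 1` -/

section Generic

variable {k : ℕ} [NeZero k] {χ : DirichletCharacter ℂ k}

/-- `Σ_{p∣k} T(p,σ) = (a₂+a₃+a₄)Σ max(G,0) − a₀ Σ help`. [cite: McCurley1984ZFR, §4 (36)] -/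
private theorem sum_tPen_eq' (k : ℕ) (σ : ℝ) :
    ∑ p ∈ k.primeFactors, tPen p σ =
      rsA234 * ∑ p ∈ k.primeFactors, max (gPen p σ) 0
        - rsA0 * ∑ p ∈ k.primeFactors, (uCorr p σ - kappa * uCorr p (sigmaOne σ)) := by
  simp only [tPen]
  rw [Finset.sum_sub_distrib, ← Finset.mul_sum, ← Finset.mul_sum]

/-- **McCurley's (27)–(29)+(36)–(37) at complex points, `|γ| ≤ 1`, orders `≥ 5`**: for `χ` primitive
mod `k` with `χ², χ³, χ⁴ ≠ χ₀`, `1 < σ ≤ 1.15`, and a zero `ρ = β + iγ` (`β > 0`, `β ≠ ½`, `|γ| ≤ 1`):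
`a₁/(σ−β) ≤ a₀/(σ−1) + K·A·log k − 5.6`. [cite: McCurley1984ZFR, §5 (first case) with §4 (27)–(29), (37)] -/
theorem assembled_mid_height (hχ : χ.IsPrimitive) (h1 : χ ≠ 1) (h2 : χ ^ 2 ≠ 1) (h3 : χ ^ 3 ≠ 1)
    (h4 : χ ^ 4 ≠ 1) {σ : ℝ} (hσ : 1 < σ) (hσ' : σ ≤ 1.15) {ρ : ℂ} (hz : χ.LFunction ρ = 0)
    (h0 : 0 < ρ.re) (hhalf : ρ.re ≠ 1 / 2) (hγ : |ρ.im| ≤ 1) :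
    rsA1 / (σ - ρ.re) ≤ rsA0 / (σ - 1) + bigK * (rsA1 + rsA2 + rsA3 + rsA4) * Real.log k - 5.6 := by
  have hP := rosser_positivity_complex χ hσ ρ.im
  have hζ := fdiff_principal_le_sharp115 (k := k) hσ hσ'
  have hm1 := DirichletTheta.fAt_le_of_zero_im hχ h1 hσ.le hz h0 hhalf
  have hm2 := fAt_induced_le (χ ^ 2) h2 hσ (2 * ρ.im)
  have hm3 := fAt_induced_le (χ ^ 3) h3 hσ (3 * ρ.im)
  have hm4 := fAt_induced_le (χ ^ 4) h4 hσ (4 * ρ.im)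
  -- the Gamma terms
  have hΓ1 := gammaDiff_le_height_one (charParity_le_one χ) hσ hσ' hγ
  have hΓ2 := gammaDiff_le_height_two (charParity_le_one (χ ^ 2)) hσ hσ' (t := 2 * ρ.im)
    (by rw [abs_mul, abs_two]; linarith)
  have hΓ3 := gammaDiff_le_height_three (charParity_le_one (χ ^ 3)) hσ hσ' (t := 3 * ρ.im)
    (by rw [abs_mul, abs_of_pos (by norm_num : (0:ℝ) < 3)]; linarith)
  have hΓ4 := gammaDiff_le_height_four (charParity_le_one (χ ^ 4)) hσ hσ' (t := 4 * ρ.im)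
    (by rw [abs_mul, abs_of_pos (by norm_num : (0:ℝ) < 4)]; linarith)
  -- the penalties
  have hT := sum_tPen_le_sharp k hσ
  rw [sum_tPen_eq', rsA234] at hT
  have hh : 0 ≤ ∑ p ∈ k.primeFactors, (uCorr p σ - kappa * uCorr p (sigmaOne σ)) :=
    Finset.sum_nonneg fun _ hp ↦ help_nonneg (Nat.prime_of_mem_primeFactors hp).two_le hσ
  have hmG : 0 ≤ ∑ p ∈ k.primeFactors, max (gPen p σ) 0 := Finset.sum_nonneg fun _ _ ↦ le_max_right _ _
  have a0 : (0 : ℝ) ≤ rsA0 := by norm_num [rsA0]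
  have a1 : (0 : ℝ) ≤ rsA1 := by norm_num [rsA1]
  have a2 : (0 : ℝ) ≤ rsA2 := by norm_num [rsA2]
  have a3 : (0 : ℝ) ≤ rsA3 := by norm_num [rsA3]
  have a4 : (0 : ℝ) ≤ rsA4 := by norm_num [rsA4]
  have e0 := mul_le_mul_of_nonneg_left hζ a0
  have e1 := mul_le_mul_of_nonneg_left (show fAt χ σ ρ.im ≤ bigK * Real.log k - 0.237 - 1 / (σ - ρ.re) by
    linarith) a1
  have e2 := mul_le_mul_of_nonneg_left (show fAt (χ ^ 2) σ (2 * ρ.im) ≤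
    bigK * Real.log k - 0.038 + ∑ p ∈ k.primeFactors, max (gPen p σ) 0 by linarith) a2
  have e3 := mul_le_mul_of_nonneg_left (show fAt (χ ^ 3) σ (3 * ρ.im) ≤
    bigK * Real.log k + 0.141 + ∑ p ∈ k.primeFactors, max (gPen p σ) 0 by linarith) a3
  have e4 := mul_le_mul_of_nonneg_left (show fAt (χ ^ 4) σ (4 * ρ.im) ≤
    bigK * Real.log k + 0.274 + ∑ p ∈ k.primeFactors, max (gPen p σ) 0 by linarith) a4
  have hc : (7.35 : ℝ) - 0.80 * rsA0 - 0.237 * rsA1 - 0.038 * rsA2 + 0.141 * rsA3 + 0.274 * rsA4 ≤ -5.6 := by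
    norm_num [rsA0, rsA1, rsA2, rsA3, rsA4]
  have key : rsA1 * (1 / (σ - ρ.re)) ≤ rsA0 * (1 / (σ - 1))
      + bigK * (rsA1 + rsA2 + rsA3 + rsA4) * Real.log k - 5.6 := by
    nlinarith [e0, e1, e2, e3, e4, hP, hT, hh, hmG, hc]
  simpa only [mul_one_div] using key

/-- **McCurley's Theorem 1, §5 clause for characters of order `≥ 5` and zeros of height `≤ 1`.**
Let `χ` be a primitive character mod `k` with `χ², χ³, χ⁴ ≠ χ₀`, `L ≥ log k`, `L ≥ log 10`, and
`ρ = β + iγ` a zero of `L(s, χ)` with `|γ| ≤ 1`. Then `β < 1 − 1/(R L)`, `R = 9.645908801`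
(`σ = 1 + r/L`, `r = 0.339013…`, and (30): `a₁r/(a₀ + KAr) − r > 1/R`).
[cite: McCurley1984ZFR, §5 (first case) and Theorem 1] -/
theorem generic_mid_height (hχ : χ.IsPrimitive) (h2 : χ ^ 2 ≠ 1) (h3 : χ ^ 3 ≠ 1) (h4 : χ ^ 4 ≠ 1)
    {L : ℝ} (hLk : Real.log k ≤ L) (hL10 : Real.log 10 ≤ L) {ρ : ℂ} (hz : χ.LFunction ρ = 0)
    (hγ : |ρ.im| ≤ 1) :
    ρ.re < 1 - 1 / (9.645908801 * L) := by
  by_contra hcon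
  have hβw := not_lt.1 hcon
  have h1 : χ ≠ 1 := fun h ↦ h2 (by rw [h, one_pow])
  have hL : 2.30258 ≤ L := log_ten_ge''.trans hL10
  have hLpos : 0 < L := by linarith
  set b₀ : ℝ := 1 / 9.645908801 with hb₀def
  have hb₀ : 0 < b₀ := by norm_num [hb₀def]
  have hβw' : 1 - b₀ / L ≤ ρ.re := by
    have : 1 / (9.645908801 * L) = b₀ / L := by rw [hb₀def, div_div, one_div]
    rw [← this]; exact hβw
  have hbL : b₀ / L ≤ 0.0451 := by
    rw [div_le_iff₀ hLpos]; norm_num [hb₀def]; linarith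
  have hβ0 : 0 < ρ.re := by linarith
  have hβh : ρ.re ≠ 1 / 2 := by intro h; rw [h] at hβw'; linarith
  have hβ1 : ρ.re < 1 := by
    by_contra hb
    exact LFunction_ne_zero_of_one_le_re χ (Or.inl h1) (not_lt.1 hb) hz
  set σ : ℝ := 1 + rOpt / L with hσdef
  have hr : (0 : ℝ) < rOpt := by norm_num [rOpt]
  have hσ1 : 1 < σ := by have := div_pos hr hLpos; linarith
  have hσ115 : σ ≤ 1.15 := by
    have : rOpt / L ≤ 0.15 := by rw [div_le_iff₀ hLpos]; norm_num [rOpt]; linarith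
    linarith
  have hβσ : ρ.re < 1 + rOpt / L := by linarith
  have hKpos := bigK_pos
  have hm := assembled_mid_height hχ h1 h2 h3 h4 hσ1 hσ115 hz hβ0 hβh hγ
  have hc : (0 : ℝ) < rsA1 := by norm_num [rsA1]
  have hc' : (0 : ℝ) ≤ rsA1 + rsA2 + rsA3 + rsA4 := by norm_num [rsA1, rsA2, rsA3, rsA4]
  refine endgame_contra (K' := bigK * (rsA1 + rsA2 + rsA3 + rsA4)) (C := -5.6) hLpos hr hb₀ hc
    (by norm_num) hβw' hβσ ?_ numeric_generic
  have : bigK * (rsA1 + rsA2 + rsA3 + rsA4) * Real.log k ≤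
      bigK * (rsA1 + rsA2 + rsA3 + rsA4) * L :=
    mul_le_mul_of_nonneg_left hLk (mul_nonneg hKpos.le hc')
  linarith

end Generic

end McCurleyStechkin

end Literature.NumberTheory.LFunctions
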